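import Summits.ValiantsHypothesis.ValiantsHypothesis.Theorems.FeketeSOSFeketeSOSHardPaleyRIPRankTwoSidon
import Summits.ValiantsHypothesis.ValiantsHypothesis.Theorems.FeketeSOSFeketeSOSHardPaleyRIPHalfSpectrumFloor

/-!
# Route FeketeSOS — crux `FeketeSOSHard` (stmt-ValiantsHypothesis-3996), line `paley-rip` v3:
# rank-two operator tameness on supports with a half-spectrum energy floor (anti-concentration mechanism, part 2)

Context: part 1 (`…PaleyRIPHalfSpectrumFloor.lean`) proves `e²‖u‖²‖v‖² ≤ ‖u ⋆ v‖²` on `ℤ/N` when `|û|²`, `|v̂|²`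
both have the half-spectrum floor `e`.  Here, in the vocabulary of the registered skeleton
`Cruxes/FeketeSOSHard/Lines/paley_rip_v3.lean` (stub `stub_tameOperator`, rank `r = 2` = product tameness, census
`Cruxes/FeketeSOSHard/Lines/paley-rip-stub3-census.md` §4, §6):

* `coeff_mul_eq_cyclicConv` — the cyclic pattern of a product `a·b` (`X^p − 1 ∣ a·b − F`, `deg F < p`) is the cyclic
  convolution of the coefficient vectors read modulo `p`;
* `norm_mul_le_of_halfSpectrumFloor` — if every polynomial supported in `S ⊆ [0,p)` has the half-spectrum floor
  `e ∈ (0,1)` (hypothesis `hfloor`: `e·Σ_k|ŵ(k)|² ≤ Σ_{k∈B}|ŵ(k)|²` for all `B ⊆ ℤ/p` with `2#B ≥ p`), then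
  `(Σ|a_s|²)(Σ|b_s|²) ≤ (#S·M/e)²` for every product pattern with `|F_n| ≤ M`: NO WILD PAIRS on `S`;
* `tameOperator_rank_two_of_halfSpectrumFloor` — hence `stub_tameOperator` at `r = 2` holds on such `S` with
  exponent `1` and constant `1/e`: mass `≤ (#S/e)·M` (P1 `exists_squares_of_mul` with balance `t² = #S·M/(e‖a‖²)`),
  in the stub's own quantifier shape (`(c_i,w_i)_{i<2}` ↦ `a·b` as in `tameOperator_rank_two_of_sidon`, p581173).

Honest framing.  CONDITIONAL rung of the anti-concentration programme: the floor hypothesis is the open part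
(census §6 (W5a)); the Slepian-row supports `D + [0,k)` of census §5 have floor `→ 0`.  Nothing here proves the
stub, the engine `stub_paleyFlatRIP`, the crux, or anything about `VP ≠ VNP`.
-/

set_option linter.dupNamespace false

namespace Summit.ValiantsHypothesis.ValiantsHypothesis.Theorems.FeketeSOSHardPaleyRIP

open Polynomial Finset
open scoped BigOperators

noncomputable section

section Line

open Literature.Analysis.Quadrature

variable (p : ℕ) [Fact p.Prime]

/-- **The cyclic pattern of a product is the cyclic convolution of the coefficient vectors.**  If
`supp a, supp b ⊆ [0,p)`, `deg F < p` and `X^p − 1 ∣ a·b − F`, then for every residue `n`,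
`F_n = Σ_{x ∈ ℤ/p} a(x)·b(n − x)` (coefficients read through `ZMod.val`; this is
`Literature.Analysis.Quadrature.cyclicConv` of the two coefficient vectors, definitionally). [folklore] -/
theorem coeff_mul_eq_cyclicConv (a b F : ℂ[X]) (ha : ∀ s ∈ a.support, s < p) (hb : ∀ t ∈ b.support, t < p)
    (hF : F.natDegree < p) (hdvd : (X : ℂ[X]) ^ p - 1 ∣ a * b - F) (n : ZMod p) :
    F.coeff n.val = ∑ x : ZMod p, a.coeff x.val * b.coeff (n - x).val := by
  classical
  have h := pairing_mul_of_dvd p (fun m => if m = n then 1 else 0) a b F hF hdvd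
  have hl : ∑ m ∈ range p, (if ((m : ℕ) : ZMod p) = n then (1 : ℂ) else 0) * F.coeff m = F.coeff n.val := by
    rw [Finset.sum_eq_single n.val]
    · simp
    · intro m hm hne
      have : ((m : ℕ) : ZMod p) ≠ n := by
        intro hmn
        apply hne
        rw [← hmn, ZMod.val_natCast, Nat.mod_eq_of_lt (mem_range.1 hm)]
      simp [this]
    · intro hn
      exact absurd (mem_range.2 (ZMod.val_lt n)) hn
  rw [hl] at h
  rw [h]
  -- for fixed `s`, the unique `t < p` with `s + t ≡ n` is `(n - s).val`
  have hinner : ∀ s ∈ a.support,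
      ∑ t ∈ b.support, (if (((s + t : ℕ) : ZMod p)) = n then (1 : ℂ) else 0) * a.coeff s * b.coeff t
        = a.coeff s * b.coeff (n - (s : ZMod p)).val := by
    intro s hs
    have key : ∀ t ∈ b.support, ((((s + t : ℕ) : ZMod p)) = n ↔ t = (n - (s : ZMod p)).val) := by
      intro t ht
      constructor
      · intro hst
        have : (t : ZMod p) = n - (s : ZMod p) := by
          rw [← hst]; push_cast; ring
        rw [← this, ZMod.val_natCast, Nat.mod_eq_of_lt (hb t ht)]
      · intro ht'
        rw [ht']; push_cast; rw [ZMod.natCast_zmod_val]; ring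
    have hsum : ∑ t ∈ b.support, (if (((s + t : ℕ) : ZMod p)) = n then (1 : ℂ) else 0) * a.coeff s * b.coeff t
        = ∑ t ∈ b.support, (if t = (n - (s : ZMod p)).val then a.coeff s * b.coeff t else 0) := by
      refine Finset.sum_congr rfl fun t ht => ?_
      by_cases ht' : t = (n - (s : ZMod p)).val
      · rw [if_pos ((key t ht).2 ht'), if_pos ht', one_mul]
      · rw [if_neg (fun h' => ht' ((key t ht).1 h')), if_neg ht', zero_mul, zero_mul]
    rw [hsum, Finset.sum_ite_eq' b.support]
    split_ifs with hmem
    · rfl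
    · rw [notMem_support_iff.1 hmem, mul_zero]
  rw [Finset.sum_congr rfl hinner]
  -- reindex `supp a ⊆ [0,p)` against `ZMod p` through `val`
  symm
  rw [← Finset.sum_subset (Finset.subset_univ ((a.support).image (fun s : ℕ => (s : ZMod p))))]
  · rw [Finset.sum_image]
    · refine Finset.sum_congr rfl fun s hs => ?_
      rw [ZMod.val_natCast, Nat.mod_eq_of_lt (ha s hs)]
    · intro s hs t ht hst
      have := (ZMod.natCast_eq_natCast_iff' s t p).1 hst
      rwa [Nat.mod_eq_of_lt (ha s hs), Nat.mod_eq_of_lt (ha t ht)] at this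
  · intro x _ hx
    have : x.val ∉ a.support := by
      intro hmem
      exact hx (Finset.mem_image.2 ⟨x.val, hmem, ZMod.natCast_zmod_val x⟩)
    rw [notMem_support_iff.1 this, zero_mul]

/-- Reading a polynomial supported in `S ⊆ [0,p)` modulo `p`: `Σ_{x ∈ ℤ/p} |w(x.val)|² = Σ_{s ∈ S} |w_s|²`.
[folklore] -/
theorem sum_zmod_norm_sq_eq (S : Finset ℕ) (hS : ∀ a ∈ S, a < p) (w : ℂ[X]) (hw : w.support ⊆ S) :
    ∑ x : ZMod p, ‖w.coeff x.val‖ ^ 2 = ∑ s ∈ S, ‖w.coeff s‖ ^ 2 := by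
  classical
  symm
  rw [← Finset.sum_subset (Finset.subset_univ (S.image (fun s : ℕ => (s : ZMod p))))]
  · rw [Finset.sum_image]
    · refine Finset.sum_congr rfl fun s hs => ?_
      rw [ZMod.val_natCast, Nat.mod_eq_of_lt (hS s hs)]
    · intro s hs t ht hst
      have := (ZMod.natCast_eq_natCast_iff' s t p).1 hst
      rwa [Nat.mod_eq_of_lt (hS s hs), Nat.mod_eq_of_lt (hS t ht)] at this
  · intro x _ hx
    have : x.val ∉ w.support := fun hmem =>
      hx (Finset.mem_image.2 ⟨x.val, hw hmem, ZMod.natCast_zmod_val x⟩)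
    rw [notMem_support_iff.1 this, norm_zero]
    ring

/-- **Wildness bound from a half-spectrum floor.**  Let `S ⊆ [0,p)` have the half-spectrum energy floor
`e ∈ (0,1)`: every `w` supported in `S` has `e·Σ_k|ŵ(k)|² ≤ Σ_{k∈B}|ŵ(k)|²` for every `B ⊆ ℤ/p` with
`2#B ≥ p` (`ŵ = ZMod.dft` of `x ↦ w_{x.val}`).  If `supp a, supp b ⊆ S`, `deg F < p`, `X^p − 1 ∣ a·b − F` and
`|F_n| ≤ M` for all `n`, then `(Σ_{s∈S}|a_s|²)(Σ_{s∈S}|b_s|²) ≤ (#S·M/e)²`: no wild pair lives on `S`. [folklore] -/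
theorem norm_mul_le_of_halfSpectrumFloor (S : Finset ℕ) (hS : ∀ a ∈ S, a < p) (e : ℝ) (he0 : 0 < e)
    (he1 : e < 1)
    (hfloor : ∀ w : ℂ[X], w.support ⊆ S → ∀ B : Finset (ZMod p), p ≤ 2 * B.card →
      e * ∑ k, ‖ZMod.dft (fun x : ZMod p => w.coeff x.val) k‖ ^ 2 ≤
        ∑ k ∈ B, ‖ZMod.dft (fun x : ZMod p => w.coeff x.val) k‖ ^ 2)
    (a b F : ℂ[X]) (ha : a.support ⊆ S) (hb : b.support ⊆ S) (M : ℝ) (hF : F.natDegree < p)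
    (hdvd : (X : ℂ[X]) ^ p - 1 ∣ a * b - F) (hM : ∀ n, ‖F.coeff n‖ ≤ M) :
    (∑ s ∈ S, ‖a.coeff s‖ ^ 2) * (∑ s ∈ S, ‖b.coeff s‖ ^ 2) ≤ ((S.card : ℝ) * M / e) ^ 2 := by
  classical
  have hp : NeZero p := ⟨(Fact.out : p.Prime).ne_zero⟩
  have hM0 : 0 ≤ M := (norm_nonneg _).trans (hM 0)
  set u : ZMod p → ℂ := fun x => a.coeff x.val with hudef
  set v : ZMod p → ℂ := fun x => b.coeff x.val with hvdef
  -- (W1)–(W3) with Plancherel: `e² ‖u‖² ‖v‖² ≤ ‖u ⋆ v‖²`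
  have hcore := conv_energy_ge_of_halfSpectrumFloor e he0.le he1 u v (hfloor a ha) (hfloor b hb)
  rw [hudef, hvdef, sum_zmod_norm_sq_eq p S hS a ha, sum_zmod_norm_sq_eq p S hS b hb] at hcore
  -- the convolution is the pattern: bounded by `M`, vanishing off `T = S + S mod p`
  have hconv : ∀ n : ZMod p, cyclicConv u v n = F.coeff n.val := fun n => by
    rw [coeff_mul_eq_cyclicConv p a b F (fun s hs => hS s (ha hs)) (fun t ht => hS t (hb ht)) hF hdvd n]
    simp only [cyclicConv, hudef, hvdef]
  set T : Finset (ZMod p) := (S ×ˢ S).image (fun ab : ℕ × ℕ => ((ab.1 + ab.2 : ℕ) : ZMod p)) with hTdef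
  have hT : ∀ n, n ∉ T → cyclicConv u v n = 0 := by
    intro n hn
    unfold cyclicConv
    refine Finset.sum_eq_zero fun x _ => ?_
    by_cases hx : x.val ∈ S
    · by_cases hy : (n - x).val ∈ S
      · exfalso
        refine hn (Finset.mem_image.2 ⟨(x.val, (n - x).val), Finset.mem_product.2 ⟨hx, hy⟩, ?_⟩)
        push_cast
        rw [ZMod.natCast_zmod_val, ZMod.natCast_zmod_val]; ring
      · have : b.coeff (n - x).val = 0 := notMem_support_iff.1 fun h => hy (hb h)
        simp [hvdef, this]
    · have : a.coeff x.val = 0 := notMem_support_iff.1 fun h => hx (ha h)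
      simp [hudef, this]
  have hTcard : (T.card : ℝ) ≤ (S.card : ℝ) ^ 2 := by
    have h1 : T.card ≤ (S ×ˢ S).card := Finset.card_image_le
    rw [Finset.card_product] at h1
    exact_mod_cast (by nlinarith [h1] : T.card ≤ S.card ^ 2)
  have hsumconv : ∑ n, ‖cyclicConv u v n‖ ^ 2 ≤ (T.card : ℝ) * M ^ 2 := by
    have hsplit : ∑ n, ‖cyclicConv u v n‖ ^ 2 = ∑ n ∈ T, ‖cyclicConv u v n‖ ^ 2 := by
      symm
      refine Finset.sum_subset (Finset.subset_univ T) fun n _ hn => ?_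
      rw [hT n hn, norm_zero]; ring
    rw [hsplit]
    calc ∑ n ∈ T, ‖cyclicConv u v n‖ ^ 2 ≤ ∑ _n ∈ T, M ^ 2 :=
          Finset.sum_le_sum fun n _ => by
            rw [hconv n]; exact pow_le_pow_left₀ (norm_nonneg _) (hM _) 2
      _ = (T.card : ℝ) * M ^ 2 := by rw [Finset.sum_const, nsmul_eq_mul]
  -- assemble: `e² αβ ≤ #T M² ≤ #S² M²`
  have he2 : 0 < e ^ 2 := by positivity
  have hαβ : e ^ 2 * ((∑ s ∈ S, ‖a.coeff s‖ ^ 2) * (∑ s ∈ S, ‖b.coeff s‖ ^ 2)) ≤ (S.card : ℝ) ^ 2 * M ^ 2 := by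
    calc e ^ 2 * ((∑ s ∈ S, ‖a.coeff s‖ ^ 2) * (∑ s ∈ S, ‖b.coeff s‖ ^ 2))
        = e ^ 2 * (∑ s ∈ S, ‖a.coeff s‖ ^ 2) * (∑ s ∈ S, ‖b.coeff s‖ ^ 2) := by ring
      _ ≤ ∑ n, ‖cyclicConv u v n‖ ^ 2 := hcore
      _ ≤ (T.card : ℝ) * M ^ 2 := hsumconv
      _ ≤ (S.card : ℝ) ^ 2 * M ^ 2 := mul_le_mul_of_nonneg_right hTcard (sq_nonneg _)
  rw [div_pow, mul_pow, le_div_iff₀ he2]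
  linarith

/-- **`stub_tameOperator` at rank 2 on supports with a half-spectrum floor (exponent 1, constant `1/e`).**
Let `S ⊆ [0,p)` have the half-spectrum energy floor `e ∈ (0,1)` (as in `norm_mul_le_of_halfSpectrumFloor`).  For
every pair of weighted squares `(c_i, w_i)_{i<2}` supported in `S` whose cyclic pattern `F` (`deg F < p`,
`X^p − 1 ∣ c₀w₀² + c₁w₁² − F`) has coefficients of modulus `≤ M`, there are weighted squares supported in `S` with
the same cyclic pattern and total mass `≤ (#S/e)·M`.  Proof: `c₀w₀² + c₁w₁² = a·b`; the floor kills wildness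
(`‖a‖‖b‖ ≤ #S·M/e`); P1 (`exists_squares_of_mul`) with the balance `t² = #S·M/(e‖a‖²)`.  Conditional rung of
the anti-concentration programme (census §6); it generalises nothing unconditionally. [folklore] -/
theorem tameOperator_rank_two_of_halfSpectrumFloor (S : Finset ℕ) (hS : ∀ a ∈ S, a < p) (e : ℝ)
    (he0 : 0 < e) (he1 : e < 1)
    (hfloor : ∀ w : ℂ[X], w.support ⊆ S → ∀ B : Finset (ZMod p), p ≤ 2 * B.card →
      e * ∑ k, ‖ZMod.dft (fun x : ZMod p => w.coeff x.val) k‖ ^ 2 ≤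
        ∑ k ∈ B, ‖ZMod.dft (fun x : ZMod p => w.coeff x.val) k‖ ^ 2)
    (c : Fin 2 → ℂ) (w : Fin 2 → ℂ[X]) (hw : ∀ i, (w i).support ⊆ S)
    (F : ℂ[X]) (M : ℝ) (hF : F.natDegree < p)
    (hdvd : (X : ℂ[X]) ^ p - 1 ∣ (∑ i, C (c i) * w i ^ 2) - F) (hM : ∀ n, ‖F.coeff n‖ ≤ M) :
    ∃ (s' : ℕ) (c' : Fin s' → ℂ) (w' : Fin s' → ℂ[X]), (∀ j, (w' j).support ⊆ S) ∧
      ((X : ℂ[X]) ^ p - 1 ∣ (∑ j, C (c' j) * w' j ^ 2) - F) ∧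
      (∑ j, sqMass (c' j) (w' j)) ≤ (S.card : ℝ) / e * M := by
  classical
  have hM0 : 0 ≤ M := (norm_nonneg _).trans (hM 0)
  -- square roots of the weights and the product form (as in `tameOperator_rank_two_of_sidon`)
  obtain ⟨γ0, hγ0⟩ : ∃ γ : ℂ, γ ^ 2 = c 0 := ⟨c 0 ^ ((2 : ℂ)⁻¹), Complex.cpow_nat_inv_pow (c 0) two_ne_zero⟩
  obtain ⟨γ1, hγ1⟩ : ∃ γ : ℂ, γ ^ 2 = c 1 := ⟨c 1 ^ ((2 : ℂ)⁻¹), Complex.cpow_nat_inv_pow (c 1) two_ne_zero⟩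
  set a : ℂ[X] := C γ0 * w 0 + C (Complex.I * γ1) * w 1 with hadef
  set b : ℂ[X] := C γ0 * w 0 + C (-(Complex.I * γ1)) * w 1 with hbdef
  have ha : a.support ⊆ S := support_lin_subset _ _ _ _ (hw 0) (hw 1)
  have hb : b.support ⊆ S := support_lin_subset _ _ _ _ (hw 0) (hw 1)
  have hab : a * b = ∑ i, C (c i) * w i ^ 2 := by
    rw [Fin.sum_univ_two, ← hγ0, ← hγ1, map_pow, map_pow, hadef, hbdef, map_neg, map_mul]
    have hI : (C Complex.I : ℂ[X]) ^ 2 = -1 := by rw [← map_pow, Complex.I_sq, map_neg, map_one]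
    linear_combination (-(C γ1 * w 1) ^ 2) * hI
  have hdvd' : (X : ℂ[X]) ^ p - 1 ∣ a * b - F := by rw [hab]; exact hdvd
  -- the trivial case `F = 0`
  by_cases hF0 : F = 0
  · refine ⟨0, Fin.elim0, Fin.elim0, fun j => Fin.elim0 j, ?_, ?_⟩
    · rw [hF0]; simp
    · simp only [Finset.univ_eq_empty, Finset.sum_empty]; positivity
  set α : ℝ := ∑ s ∈ S, ‖a.coeff s‖ ^ 2 with hαdef
  set β : ℝ := ∑ s ∈ S, ‖b.coeff s‖ ^ 2 with hβdef
  have hα0 : 0 ≤ α := Finset.sum_nonneg fun s _ => sq_nonneg _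
  have hβ0 : 0 ≤ β := Finset.sum_nonneg fun s _ => sq_nonneg _
  have hαpos : 0 < α := by
    rcases hα0.lt_or_eq with h | h
    · exact h
    · exfalso
      have hzero : ∀ s ∈ S, a.coeff s = 0 := by
        intro s hs
        have := (Finset.sum_eq_zero_iff_of_nonneg (fun s _ => sq_nonneg ‖a.coeff s‖)).1 h.symm s hs
        exact norm_eq_zero.1 ((pow_eq_zero_iff two_ne_zero).1 this)
      have ha0 : a = 0 := by
        ext s
        by_cases hs : s ∈ a.support
        · exact hzero s (ha hs)
        · exact notMem_support_iff.1 hs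
      apply hF0
      refine eq_zero_of_dvd_of_lt p hF ?_
      have : (X : ℂ[X]) ^ p - 1 ∣ -(a * b - F) := dvd_neg.2 hdvd'
      rwa [ha0, zero_mul, zero_sub, neg_neg] at this
  have hMpos : 0 < M := by
    obtain ⟨n, hn⟩ : ∃ n, F.coeff n ≠ 0 := by
      by_contra hall
      push Not at hall
      exact hF0 (Polynomial.ext fun n => by rw [hall n, coeff_zero])
    exact lt_of_lt_of_le (norm_pos_iff.2 hn) (hM n)
  have hSpos : 0 < (S.card : ℝ) := by
    have : S.Nonempty := by
      by_contra hS'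
      rw [Finset.not_nonempty_iff_eq_empty] at hS'
      rw [hαdef, hS', Finset.sum_empty] at hαpos
      exact lt_irrefl _ hαpos
    exact_mod_cast this.card_pos
  -- the floor: `α β ≤ (#S M / e)²`
  have hαβ : α * β ≤ ((S.card : ℝ) * M / e) ^ 2 :=
    norm_mul_le_of_halfSpectrumFloor p S hS e he0 he1 hfloor a b F ha hb M hF hdvd' hM
  -- balance `t² = T := #S M / (e α)`
  set K : ℝ := (S.card : ℝ) * M / e with hKdef
  have hKpos : 0 < K := by positivity
  set T : ℝ := K / α with hTdef
  have hTpos : 0 < T := by positivity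
  obtain ⟨c', w', hsupp', hdvd'', hmass⟩ :=
    exists_squares_of_mul p S a b F ha hb hdvd' (Real.sqrt T) (Real.sqrt_pos.2 hTpos)
  refine ⟨2, c', w', hsupp', hdvd'', hmass.trans ?_⟩
  rw [Real.sq_sqrt hTpos.le]
  have hTα : T * α = K := by rw [hTdef]; field_simp
  have hβT : β / T ≤ K := by
    rw [div_le_iff₀ hTpos, hTdef]
    rw [show K * (K / α) = K ^ 2 / α by ring, le_div_iff₀ hαpos]
    nlinarith [hαβ]
  rw [← hαdef, ← hβdef, hTα]
  have : (S.card : ℝ) / e * M = K := by rw [hKdef]; ring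
  rw [this]
  linarith [hβT]

end Line

end

end Summit.ValiantsHypothesis.ValiantsHypothesis.Theorems.FeketeSOSHardPaleyRIP
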